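import Literature.Topology.FourManifolds.GompfTubeMoves
import Literature.Topology.FourManifolds.TubeLinearReframe
import Literature.Topology.FourManifolds.GompfTheorem43
import Literature.AlgebraicTopology.FundamentalGroup.PosDetMatrixFundamentalGroup
import HarnessLib

/-!
# Conjugation invariance of Gompf's framed Cappell–Shaneson spheres (leaf **Cj**, discharged)

`Literature.Topology.FourManifolds.gompf2010_conj_invariance` (`GompfTheorem43.lean`) is Gompf's remark (Gompf 2010, §3 ¶1:
the pair of Cappell–Shaneson spheres of `A` "only depends on the conjugacy class of `A`"; proof
of Thm 4.3: "`B = C A C⁻¹` … Since conjugation preserves linear straightenings, we obtain a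
diffeomorphism from `X^{σ_A}_A` to `X^{σ_B}_B`") on the tree's concrete spheres: for
`C ∈ SL(3, ℤ)` and a smooth framing path `γ : 1 ⟿ A`,
`gompfSphere (C A C⁻¹) (C γ C⁻¹) ≃ₘ gompfSphere A γ`. This file **proves** it
(`Literature.Topology.FourManifolds.gompf2010_conj_invariance_holds`).

## The argument

1. *The mapping tori.* The linear diffeomorphism `torusMap C × id` of the two cylinders
   `T³ × (0, 1)`, `T³ × (1/2, 3/2)` conjugates the gluing relation
   (`(x, s) ∼ (A x, s + 1)` becomes `(C x, s) ∼ (C A C⁻¹ (C x), s + 1)`), so by uniqueness of open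
   gluings with witnesses (`IsOpenGluingWith.exists_diffeomorph_apply_eq`) it descends to a
   diffeomorphism `Ψ : CSTorus A ≃ₘ CSTorus (C A C⁻¹)` with `Ψ [x, s] = [C x, s]`
   (`Literature.Topology.FourManifolds.csConj`), mapping the section circle to the section circle.
2. *The tubes.* `Ψ` carries the tube `ν_γ (u, w) = [expT (γ(2s) · sh_ε w), s]` of the section
   circle to `[expT (C γ(2s) · sh_ε w), s]`, whereas the tube of the conjugate framing is
   `ν_{γ^C} (u, w) = [expT (C γ(2s) C⁻¹ · sh_{ε'} w), s]` (`sh_ε = univBall 0 ε`, `ε, ε'` the two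
   tube radii). They differ by the *constant* change of fibre coordinates
   `sh_ε⁻¹ ∘ C⁻¹ ∘ sh_{ε'}`, which need not be defined on the whole unit ball. We therefore insert
   a small scalar `c`: the operator `C⁻¹ ∈ SL(3, ℝ) ⊆ GL⁺(3, ℝ)` is joined to `1` by a path
   (`GL⁺(3, ℝ)` is path connected: Gram–Schmidt onto `SO(3)`, the image of `S³`;
   `Literature.Topology.FourManifolds.pathConnectedSpace_posDetMatrix_three`), hence is a finite product of operators within
   the straightening threshold of the identity (`Literature.Topology.FourManifolds.exists_list_prod_eq_of_path`, a telescoping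
   product along the path); composing the corresponding compactly supported straightenings of
   `FibreStraightening` after a compactly supported contraction gives a diffeomorphism `T` of `ℝ³`
   equal to `c · C⁻¹` on the core ball and to the identity near and beyond the sphere of radius
   `ε` (`Literature.Topology.FourManifolds.reframeCoreFun`), and `g := sh_ε⁻¹ ∘ T ∘ sh_ε` is a diffeomorphism of `ℝ³` equal to
   the identity off `B(0, 7/2)` (`Literature.Topology.FourManifolds.ballConj`). On the unit ball
   `Ψ (ν_γ (u, g w)) = ν_{γ^C} (u, k w)` with `k := sh_{ε'}⁻¹ ∘ (κ ·) ∘ sh_{ε'}` the shrink by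
   `κ := c ε / ε'` (`Literature.Topology.FourManifolds.secNbhdFun_conj_eq`).
3. *The surgeries.* `ν.Surgered ≅ (Ψ ∘ ν).Surgered` (transport,
   `CircleNbhd.nonempty_diffeomorph_surgered_map`) `≅ (Ψ ∘ ν ∘ (id × g)).Surgered`
   (`TubeReparam`: reparametrising the tube by a compactly supported diffeomorphism fixing the zero
   section) `≅ ν_{γ^C}.Surgered` (`TubeReparam` again, with the shrink `id × k`, the two tubes
   agreeing on the unit ball bundle). This is Gompf–Stipsicz §5.2: the surgery only depends on
   the framed circle up to isotopy.

## References
* R. E. Gompf, *More Cappell–Shaneson spheres are standard*, AGT 10 (2010), §3 ¶1, Thm 4.3.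
* R. E. Gompf, A. I. Stipsicz, *4-Manifolds and Kirby Calculus*, GSM 20 (1999), §5.2.
* A. Hatcher, *Algebraic Topology* (2002), §3.D (`GLₙ(ℝ)` deformation retracts onto `O(n)`).
-/

noncomputable section

open scoped Manifold ContDiff Topology
open Set Function Metric OpenPartialHomeomorph

universe u

namespace Literature.Topology.FourManifolds

/-- Local notation: `𝔼 n` is the model Euclidean space `EuclideanSpace ℝ (Fin n)`. -/
local notation "𝔼 " n:arg => EuclideanSpace ℝ (Fin n)

/-- Local notation: `𝕊 n` is the unit sphere in `EuclideanSpace ℝ (Fin (n + 1))`. -/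
local notation "𝕊 " n:arg => (Metric.sphere (0 : EuclideanSpace ℝ (Fin (n + 1))) 1 : Set _)

/-- Local notation: the model with corners `𝓣 = (𝓡 1).prod ((𝓡 1).prod (𝓡 1))` of `ThreeTorus`. -/
local notation "𝓣" =>
  (ModelWithCorners.prod (𝓡 1) (ModelWithCorners.prod (𝓡 1) (𝓡 1)))

/-! ### Near-identity factorisations along a path of invertible elements -/

section Factor

variable {R : Type*} [NormedRing R]

/-- **Telescoping factorisation.** If `P : [0, 1] → R` is a continuous path of invertible
elements of a normed ring with continuous (two-sided) inverse `Q` and `P 0 = 1`, then for every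
`η > 0` the end point `P 1` is a finite product of elements within `η` of `1`: with a fine enough
partition `tᵢ = i/N`, `P 1 = (P t_N Q t_{N-1}) ⋯ (P t₂ Q t₁) (P t₁ Q t₀)` and
`‖P tᵢ₊₁ Q tᵢ - 1‖ = ‖(P tᵢ₊₁ - P tᵢ) Q tᵢ‖ ≤ sup ‖Q‖ · osc P`. [folklore] -/
theorem exists_list_prod_eq_of_path {P Q : ℝ → R} (hP : Continuous P) (hQ : Continuous Q)
    (hPQ : ∀ t, P t * Q t = 1) (hQP : ∀ t, Q t * P t = 1) (h0 : P 0 = 1) {η : ℝ} (hη : 0 < η) :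
    ∃ l : List R, (∀ L ∈ l, ‖L - 1‖ ≤ η) ∧ l.prod = P 1 := by
  -- a bound for `Q` on `[0, 1]`
  obtain ⟨K, hK⟩ := (isCompact_Icc (a := (0 : ℝ)) (b := 1)).exists_bound_of_continuousOn
    hQ.continuousOn
  set K' : ℝ := max K 1 with hK'
  have hK'pos : 0 < K' := lt_of_lt_of_le one_pos (le_max_right _ _)
  have hQle : ∀ t ∈ Icc (0 : ℝ) 1, ‖Q t‖ ≤ K' := fun t ht ↦ (hK t ht).trans (le_max_left _ _)
  -- uniform continuity of `P` on `[0, 1]`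
  obtain ⟨δ, hδ, hδP⟩ := Metric.uniformContinuousOn_iff.1
    ((isCompact_Icc (a := (0 : ℝ)) (b := 1)).uniformContinuousOn_of_continuous hP.continuousOn)
    (η / K') (div_pos hη hK'pos)
  obtain ⟨n, hn⟩ := exists_nat_one_div_lt hδ
  -- the nodes `tᵢ = i / (n + 1)`
  set N : ℝ := (n : ℝ) + 1 with hN
  have hNpos : 0 < N := by positivity
  set t : ℕ → ℝ := fun i ↦ (i : ℝ) / N with ht
  have ht_mem : ∀ i, i ≤ n + 1 → t i ∈ Icc (0 : ℝ) 1 := fun i hi ↦ by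
    refine ⟨div_nonneg (Nat.cast_nonneg _) hNpos.le, ?_⟩
    rw [ht]
    dsimp only
    rw [div_le_one hNpos, hN]
    exact_mod_cast hi
  have ht_dist : ∀ i, dist (t (i + 1)) (t i) < δ := fun i ↦ by
    have h1 : t (i + 1) - t i = 1 / N := by
      rw [ht]
      dsimp only
      rw [div_sub_div_same, Nat.cast_succ, add_sub_cancel_left]
    rw [Real.dist_eq, h1, abs_of_pos (by positivity)]
    exact hn
  set L : ℕ → R := fun i ↦ P (t (i + 1)) * Q (t i) with hL
  -- telescoping
  have htel : ∀ k, (((List.range k).map L).reverse).prod = P (t k) := by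
    intro k
    induction k with
    | zero =>
      rw [List.range_zero, List.map_nil, List.reverse_nil, List.prod_nil, ht]
      dsimp only
      rw [Nat.cast_zero, zero_div, h0]
    | succ k ih =>
      rw [List.range_succ, List.map_append, List.reverse_append, List.map_singleton,
        List.reverse_singleton, List.singleton_append, List.prod_cons, ih, hL]
      dsimp only
      rw [mul_assoc, hQP, mul_one]
  refine ⟨((List.range (n + 1)).map L).reverse, fun M hM ↦ ?_, ?_⟩
  · rw [List.mem_reverse, List.mem_map] at hM
    obtain ⟨i, hi, rfl⟩ := hM
    rw [List.mem_range] at hi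
    have h1 : L i - 1 = (P (t (i + 1)) - P (t i)) * Q (t i) := by
      rw [hL]
      dsimp only
      rw [sub_mul, hPQ]
    rw [h1]
    have h2 : ‖P (t (i + 1)) - P (t i)‖ ≤ η / K' := by
      rw [← dist_eq_norm]
      exact (hδP _ (ht_mem _ (by omega)) _ (ht_mem _ (by omega)) (ht_dist i)).le
    calc ‖(P (t (i + 1)) - P (t i)) * Q (t i)‖ ≤ ‖P (t (i + 1)) - P (t i)‖ * ‖Q (t i)‖ :=
          norm_mul_le _ _
      _ ≤ η / K' * K' :=
          mul_le_mul h2 (hQle _ (ht_mem _ (by omega))) (norm_nonneg _) (div_pos hη hK'pos).le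
      _ = η := div_mul_cancel₀ _ hK'pos.ne'
  · rw [htel, ht]
    dsimp only
    rw [show ((n + 1 : ℕ) : ℝ) = N by rw [hN]; push_cast; rfl, div_self hNpos.ne']

end Factor

/-! ### `GL⁺(3, ℝ)` is path connected; operators of `SL(3, ℤ)` as products of near-identity factors -/

section PosDet

/-- **Every element of `GL⁺(3, ℝ)` is joined to `1`**: the Gram–Schmidt deformation joins `M` to
`incl (r M) ∈ SO(3)` (`GLPos3.deform`), and `SO(3)` is the continuous image of the path connected
`S³` (`rotHom`). [cite: HatcherAT2002, §3.D (GLₙ(ℝ) deformation retracts onto O(n); SO(3) ≈ ℝP³)] -/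
theorem _root_.Literature.AlgebraicTopology.FundamentalGroup.GLPos3.joined_onePt (M : Literature.AlgebraicTopology.FundamentalGroup.GLPos3) : Joined Literature.AlgebraicTopology.FundamentalGroup.GLPos3.onePt M := by
  obtain ⟨q, hq⟩ := Literature.AlgebraicTopology.FundamentalGroup.surjective_rotHom (Literature.AlgebraicTopology.FundamentalGroup.GLPos3.retr M)
  let p := PathConnectedSpace.somePath (1 : Metric.sphere (0 : Quaternion ℝ) 1) q
  let p₁ : Path Literature.AlgebraicTopology.FundamentalGroup.GLPos3.onePt (Literature.AlgebraicTopology.FundamentalGroup.GLPos3.incl (Literature.AlgebraicTopology.FundamentalGroup.GLPos3.retr M)) :=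
    (p.map (Literature.AlgebraicTopology.FundamentalGroup.GLPos3.incl.continuous.comp Literature.AlgebraicTopology.FundamentalGroup.continuous_rotHom)).cast
      (by rw [comp_apply, map_one, Literature.AlgebraicTopology.FundamentalGroup.GLPos3.incl_one]) (by rw [comp_apply, hq])
  let p₂ : Path M (Literature.AlgebraicTopology.FundamentalGroup.GLPos3.incl (Literature.AlgebraicTopology.FundamentalGroup.GLPos3.retr M)) :=
    { toFun := fun s ↦ Literature.AlgebraicTopology.FundamentalGroup.GLPos3.deform (s, M)
      continuous_toFun := Literature.AlgebraicTopology.FundamentalGroup.GLPos3.deform.continuous.comp (continuous_id.prodMk continuous_const)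
      source' := Literature.AlgebraicTopology.FundamentalGroup.GLPos3.deform_zero M
      target' := Literature.AlgebraicTopology.FundamentalGroup.GLPos3.deform_one M }
  exact ⟨p₁.trans p₂.symm⟩

/-- **`GL⁺(3, ℝ)` (`PosDetMatrix 3`) is path connected.** [cite: HatcherAT2002, §3.D (GLₙ(ℝ) deformation retracts onto O(n); SO(3) ≈ ℝP³)] -/
instance pathConnectedSpace_posDetMatrix_three : PathConnectedSpace (PosDetMatrix 3) :=
  ⟨⟨1⟩, fun x y ↦ (Literature.AlgebraicTopology.FundamentalGroup.GLPos3.joined_onePt x).symm.trans (Literature.AlgebraicTopology.FundamentalGroup.GLPos3.joined_onePt y)⟩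

/-- A real `3 × 3` matrix as an operator is the sum of its entries times the elementary
operators. [folklore] -/
theorem matCLM_eq_sum (N : Matrix (Fin 3) (Fin 3) ℝ) :
    matCLM N = ∑ i, ∑ j, N i j • matCLM (Matrix.single i j 1) := by
  conv_lhs => rw [Matrix.matrix_eq_sum_single N]
  simp only [map_sum]
  refine Finset.sum_congr rfl fun i _ ↦ Finset.sum_congr rfl fun j _ ↦ ?_
  rw [← map_smul, Matrix.smul_single, smul_eq_mul, mul_one]

/-- `N ↦ matCLM N` is continuous. [folklore] -/
theorem continuous_matCLM : Continuous fun N : Matrix (Fin 3) (Fin 3) ℝ ↦ matCLM N := by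
  have h : (fun N : Matrix (Fin 3) (Fin 3) ℝ ↦ matCLM N) =
      fun N ↦ ∑ i, ∑ j, N i j • matCLM (Matrix.single i j 1) := funext matCLM_eq_sum
  rw [h]
  exact continuous_finsetSum _ fun i _ ↦ continuous_finsetSum _ fun j _ ↦
    (continuous_id.matrix_elem i j).smul continuous_const

/-- **The operator of a matrix of `SL(3, ℤ)` is a finite product of operators within any `η > 0`
of the identity**: join `1` to the matrix inside `GL⁺(3, ℝ)` and telescope along the path. [folklore] -/
theorem exists_list_prod_eq_matCLM (C : Matrix.SpecialLinearGroup (Fin 3) ℤ) {η : ℝ} (hη : 0 < η) :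
    ∃ l : List (𝔼 3 →L[ℝ] 𝔼 3), (∀ L ∈ l, ‖L - 1‖ ≤ η) ∧ l.prod = matCLM (slRealMatrix C) := by
  let p : Path (1 : PosDetMatrix 3) (slPoint C) := PathConnectedSpace.somePath _ _
  let m : ℝ → Matrix (Fin 3) (Fin 3) ℝ := fun t ↦ (p.extend t).1
  have hm : Continuous m := continuous_subtype_val.comp p.continuous_extend
  have hdet : ∀ t, (m t).det ≠ 0 := fun t ↦ (p.extend t).2.ne'
  let mi : ℝ → Matrix (Fin 3) (Fin 3) ℝ := fun t ↦ ((m t).det)⁻¹ • (m t).adjugate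
  have hmi : Continuous mi := (hm.matrix_det.inv₀ hdet).smul hm.matrix_adjugate
  have h1 : ∀ t, m t * mi t = 1 := fun t ↦ by
    show m t * (((m t).det)⁻¹ • (m t).adjugate) = 1
    rw [Matrix.mul_smul, Matrix.mul_adjugate, smul_smul, inv_mul_cancel₀ (hdet t), one_smul]
  have h2 : ∀ t, mi t * m t = 1 := fun t ↦ by
    show ((m t).det)⁻¹ • (m t).adjugate * m t = 1
    rw [Matrix.smul_mul, Matrix.adjugate_mul, smul_smul, inv_mul_cancel₀ (hdet t), one_smul]
  obtain ⟨l, hl, hprod⟩ := exists_list_prod_eq_of_path (P := fun t ↦ matCLM (m t))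
    (Q := fun t ↦ matCLM (mi t)) (continuous_matCLM.comp hm) (continuous_matCLM.comp hmi)
    (fun t ↦ by show matCLM (m t) * matCLM (mi t) = 1; rw [← matCLM_mul, h1, matCLM_one])
    (fun t ↦ by show matCLM (mi t) * matCLM (m t) = 1; rw [← matCLM_mul, h2, matCLM_one])
    (by show matCLM (p.extend 0).1 = 1; rw [p.extend_zero, PosDetMatrix.coe_one, matCLM_one]) hη
  refine ⟨l, hl, ?_⟩
  rw [hprod]
  show matCLM (p.extend 1).1 = matCLM (slRealMatrix C)
  rw [p.extend_one]

end PosDet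

/-! ### Composite straightenings: a compactly supported diffeomorphism equal to `c · L` on the core ball -/

section StraightenList

variable {ρ : ℝ}

/-- **Iterated straightening**: the composition of the straightenings (`FibreStraightening`) of
the operators of a list, all at the same scale `ρ`. [cite: Hirsch1976, Ch. 8 §3, proof of Thm 3.1 (inserting a bump function)] -/
def straightenListFun (ρ : ℝ) : List (𝔼 3 →L[ℝ] 𝔼 3) → 𝔼 3 → 𝔼 3
  | [] => id
  | L :: l => straightenFun coreBump ρ L ∘ straightenListFun ρ l

/-- The iterated straightening of the empty list is the identity. [folklore] -/
@[simp] theorem straightenListFun_nil : straightenListFun ρ [] = id := rfl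

/-- The iterated straightening of `L :: l`. [folklore] -/
theorem straightenListFun_cons (L : 𝔼 3 →L[ℝ] 𝔼 3) (l : List (𝔼 3 →L[ℝ] 𝔼 3)) :
    straightenListFun ρ (L :: l) = straightenFun coreBump ρ L ∘ straightenListFun ρ l := rfl

/-- The iterated straightening fixes `0`. [folklore] -/
@[simp] theorem straightenListFun_apply_zero (l : List (𝔼 3 →L[ℝ] 𝔼 3)) :
    straightenListFun ρ l 0 = 0 := by
  induction l with
  | nil => rfl
  | cons L l ih => rw [straightenListFun_cons, comp_apply, ih, straightenFun_apply_zero]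

variable (hρ : 0 < ρ)
include hρ

/-- Off `B(0, (17/5) ρ)` the iterated straightening is the identity. [folklore] -/
theorem straightenListFun_of_le_norm (l : List (𝔼 3 →L[ℝ] 𝔼 3)) {y : 𝔼 3}
    (hy : ρ * (17 / 5) ≤ ‖y‖) : straightenListFun ρ l y = y := by
  induction l with
  | nil => rfl
  | cons L l ih =>
    rw [straightenListFun_cons, comp_apply, ih]
    exact straightenFun_of_le_norm _ hρ _ (by show ρ * (17 / 5) ≤ ‖y‖; exact hy)

omit hρ in
/-- Products of operators of norm `≤ 7/6`. [folklore] -/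
theorem norm_list_prod_le (l : List (𝔼 3 →L[ℝ] 𝔼 3)) (h : ∀ L ∈ l, ‖L‖ ≤ 7 / 6) :
    ‖l.prod‖ ≤ (7 / 6) ^ l.length := by
  induction l with
  | nil =>
    rw [List.prod_nil, List.length_nil, pow_zero]
    exact ContinuousLinearMap.norm_id_le
  | cons L l ih =>
    rw [List.prod_cons, List.length_cons, pow_succ']
    exact (norm_mul_le _ _).trans (mul_le_mul (h L List.mem_cons_self)
      (ih fun M hM ↦ h M (List.mem_cons_of_mem _ hM)) (norm_nonneg _) (by norm_num))

/-- **On the ball `B̄(0, 3ρ (6/7)^{|l|})` the iterated straightening is the product operator**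
(each partial product keeps the point inside the core ball `B̄(0, 3ρ)` where the next factor is
linear). [folklore] -/
theorem straightenListFun_of_norm_le (l : List (𝔼 3 →L[ℝ] 𝔼 3)) (h : ∀ L ∈ l, ‖L‖ ≤ 7 / 6)
    {y : 𝔼 3} (hy : ‖y‖ ≤ ρ * 3 * (6 / 7) ^ l.length) : straightenListFun ρ l y = l.prod y := by
  induction l generalizing y with
  | nil => rw [List.prod_nil]; rfl
  | cons L l ih =>
    have hl : ∀ M ∈ l, ‖M‖ ≤ 7 / 6 := fun M hM ↦ h M (List.mem_cons_of_mem _ hM)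
    rw [List.length_cons, pow_succ] at hy
    have hy' : ‖y‖ ≤ ρ * 3 * (6 / 7) ^ l.length := by
      refine hy.trans ?_
      rw [← mul_assoc]
      exact mul_le_of_le_one_right (by positivity) (by norm_num)
    rw [straightenListFun_cons, comp_apply, ih hl hy', List.prod_cons]
    show straightenFun coreBump ρ L (l.prod y) = L (l.prod y)
    apply straightenFun_of_norm_le _ hρ
    show ‖l.prod y‖ ≤ ρ * 3
    have hρ3 : 0 ≤ ρ * 3 := by positivity
    calc ‖l.prod y‖ ≤ ‖l.prod‖ * ‖y‖ := ContinuousLinearMap.le_opNorm _ _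
      _ ≤ (7 / 6) ^ l.length * (ρ * 3 * ((6 / 7) ^ l.length * (6 / 7))) :=
          mul_le_mul (norm_list_prod_le l hl) hy (norm_nonneg _) (by positivity)
      _ = ρ * 3 * (6 / 7) * ((7 / 6) * (6 / 7)) ^ l.length := by rw [mul_pow]; ring
      _ ≤ ρ * 3 := by norm_num; linarith

/-- **The iterated straightening is a diffeomorphism** when all factors are within the
straightening threshold of the identity. [folklore] -/
theorem exists_diffeomorph_straightenListFun (l : List (𝔼 3 →L[ℝ] 𝔼 3))
    (h : ∀ L ∈ l, ‖L - 1‖ ≤ straightenThreshold (coreBump (E := 𝔼 3))) :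
    ∃ D : 𝔼 3 ≃ₘ⟮𝓘(ℝ, 𝔼 3), 𝓘(ℝ, 𝔼 3)⟯ 𝔼 3, ⇑D = straightenListFun ρ l := by
  induction l with
  | nil => exact ⟨Diffeomorph.refl _ _ _, rfl⟩
  | cons L l ih =>
    obtain ⟨D, hD⟩ := ih fun M hM ↦ h M (List.mem_cons_of_mem _ hM)
    refine ⟨D.trans (straightenDiffeo coreBump hρ L (h L List.mem_cons_self)), ?_⟩
    rw [Diffeomorph.coe_trans, coe_straightenDiffeo, hD, straightenListFun_cons]

end StraightenList

/-! ### The core map `T = S_l ∘ D_c` and its conjugate by `univBall` -/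

section Reframe

variable {ε : ℝ} (hε : 0 < ε)

/-- **The core map** `T := S_l ∘ D_c`: the compactly supported contraction by `c` at scale
`ρ = (6/25) ε` followed by the iterated straightening of the list `l`; supported in
`B(0, (24/25) ε)`. [cite: Hirsch1976, Ch. 8 §3, proof of Thm 3.1 (inserting a bump function)] -/
def reframeCoreFun (l : List (𝔼 3 →L[ℝ] 𝔼 3)) (c : ℝ) : 𝔼 3 → 𝔼 3 :=
  straightenListFun (coreRadius ε) l ∘ contractDiffeo (coreRadius_pos hε) c

/-- Off `B(0, (24/25) ε)` the core map is the identity. [folklore] -/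
theorem reframeCoreFun_of_le_norm (l : List (𝔼 3 →L[ℝ] 𝔼 3)) (c : ℝ) {y : 𝔼 3}
    (hy : ε * (24 / 25) ≤ ‖y‖) : reframeCoreFun hε l c y = y := by
  rw [reframeCoreFun, comp_apply,
    contractDiffeo_of_le_norm _ c (by show 6 / 25 * ε * 4 ≤ ‖y‖; linarith),
    straightenListFun_of_le_norm (coreRadius_pos hε) l (by show 6 / 25 * ε * (17 / 5) ≤ ‖y‖; linarith)]

/-- **On `B̄(0, (18/25) ε)` the core map is `c · Π l`** (for `0 < c ≤ (6/7)^{|l|}` and factors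
of norm `≤ 7/6`). [folklore] -/
theorem reframeCoreFun_of_norm_le {l : List (𝔼 3 →L[ℝ] 𝔼 3)} (hl : ∀ L ∈ l, ‖L‖ ≤ 7 / 6)
    {c : ℝ} (hc : 0 < c) (hc1 : c ≤ (6 / 7) ^ l.length) {y : 𝔼 3} (hy : ‖y‖ ≤ ε * (18 / 25)) :
    reframeCoreFun hε l c y = c • l.prod y := by
  have hc1' : c ≤ 1 := hc1.trans (pow_le_one₀ (by norm_num) (by norm_num))
  rw [reframeCoreFun, comp_apply,
    contractDiffeo_of_norm_le _ hc hc1' (by show ‖y‖ ≤ 6 / 25 * ε * (7 / 2); linarith),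
    straightenListFun_of_norm_le (coreRadius_pos hε) l hl, ContinuousLinearMap.map_smul]
  rw [norm_smul, Real.norm_of_nonneg hc.le]
  calc c * ‖y‖ ≤ (6 / 7) ^ l.length * (ε * (18 / 25)) := mul_le_mul hc1 hy (norm_nonneg _) (by positivity)
    _ = coreRadius ε * 3 * (6 / 7) ^ l.length := by unfold coreRadius; ring

/-- The core map fixes `0`. [folklore] -/
@[simp] theorem reframeCoreFun_apply_zero (l : List (𝔼 3 →L[ℝ] 𝔼 3)) (c : ℝ) :
    reframeCoreFun hε l c 0 = 0 := by
  rw [reframeCoreFun, comp_apply, contractDiffeo_apply_zero, straightenListFun_apply_zero]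

/-- **The core map is a diffeomorphism** (for factors within the straightening threshold). [folklore] -/
theorem exists_diffeomorph_reframeCoreFun (l : List (𝔼 3 →L[ℝ] 𝔼 3))
    (h : ∀ L ∈ l, ‖L - 1‖ ≤ straightenThreshold (coreBump (E := 𝔼 3))) (c : ℝ) :
    ∃ D : 𝔼 3 ≃ₘ⟮𝓘(ℝ, 𝔼 3), 𝓘(ℝ, 𝔼 3)⟯ 𝔼 3, ⇑D = reframeCoreFun hε l c := by
  obtain ⟨D, hD⟩ := exists_diffeomorph_straightenListFun (coreRadius_pos hε) l h
  exact ⟨(contractDiffeo (coreRadius_pos hε) c).trans D, by rw [Diffeomorph.coe_trans, hD]; rfl⟩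

/-! #### Conjugating a diffeomorphism supported inside `B(0, ε)` by `univBall 0 ε` -/

variable (D : 𝔼 3 ≃ₘ⟮𝓘(ℝ, 𝔼 3), 𝓘(ℝ, 𝔼 3)⟯ 𝔼 3) (hD : ∀ y, ε * (24 / 25) ≤ ‖y‖ → D y = y)
include hD

include hε in
/-- A diffeomorphism that is the identity near and beyond the sphere `‖y‖ = (24/25) ε` keeps
`B(0, ε)`. [folklore] -/
theorem norm_apply_lt_of_eq_self {y : 𝔼 3} (hy : ‖y‖ < ε) : ‖D y‖ < ε :=
  norm_lt_of_bijective_of_eq_self D.bijective (fun z hz ↦ hD z (by nlinarith)) hy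

/-- Its inverse is also the identity there. [folklore] -/
theorem symm_apply_eq_self {y : 𝔼 3} (hy : ε * (24 / 25) ≤ ‖y‖) : D.symm y = y :=
  D.injective (by
    show D (D.symm y) = D y
    rw [Diffeomorph.apply_symm_apply, hD y hy])

include hε in
/-- Its inverse keeps `B(0, ε)`. [folklore] -/
theorem norm_symm_apply_lt_of_eq_self {y : 𝔼 3} (hy : ‖y‖ < ε) : ‖D.symm y‖ < ε :=
  norm_lt_of_bijective_of_eq_self D.symm.bijective
    (fun z hz ↦ symm_apply_eq_self D hD (by nlinarith)) hy

/-- **The conjugate `sh_ε⁻¹ ∘ D ∘ sh_ε`** (`sh_ε = univBall 0 ε : ℝ³ ≅ B(0, ε)`) of a diffeomorphism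
`D` supported inside `B(0, ε)`: a diffeomorphism of `ℝ³`, the identity off `B(0, 7/2)`. [cite: GompfStipsiczGSM1999, §5.2] -/
def ballConj : 𝔼 3 ≃ₘ⟮𝓘(ℝ, 𝔼 3), 𝓘(ℝ, 𝔼 3)⟯ 𝔼 3 :=
  have hsrc : ∀ y : 𝔼 3, y ∈ (univBall (0 : 𝔼 3) ε).source := fun y ↦ by
    rw [univBall_source]; exact mem_univ _
  have htgt : ∀ y : 𝔼 3, ‖y‖ < ε → y ∈ (univBall (0 : 𝔼 3) ε).target := fun y hy ↦ by
    rw [univBall_target _ hε, mem_ball_zero_iff]; exact hy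
  { toFun := fun y ↦ (univBall (0 : 𝔼 3) ε).symm (D (univBall (0 : 𝔼 3) ε y))
    invFun := fun y ↦ (univBall (0 : 𝔼 3) ε).symm (D.symm (univBall (0 : 𝔼 3) ε y))
    left_inv := fun y ↦ by
      show (univBall (0 : 𝔼 3) ε).symm (D.symm (univBall (0 : 𝔼 3) ε
        ((univBall (0 : 𝔼 3) ε).symm (D (univBall (0 : 𝔼 3) ε y))))) = y
      rw [(univBall (0 : 𝔼 3) ε).right_inv
          (htgt _ (norm_apply_lt_of_eq_self hε D hD (norm_univBall_zero_lt hε y))),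
        Diffeomorph.symm_apply_apply]
      exact (univBall (0 : 𝔼 3) ε).left_inv (hsrc y)
    right_inv := fun y ↦ by
      show (univBall (0 : 𝔼 3) ε).symm (D (univBall (0 : 𝔼 3) ε
        ((univBall (0 : 𝔼 3) ε).symm (D.symm (univBall (0 : 𝔼 3) ε y))))) = y
      rw [(univBall (0 : 𝔼 3) ε).right_inv
          (htgt _ (norm_symm_apply_lt_of_eq_self hε D hD (norm_univBall_zero_lt hε y))),
        Diffeomorph.apply_symm_apply]
      exact (univBall (0 : 𝔼 3) ε).left_inv (hsrc y)
    contMDiff_toFun := by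
      refine contMDiff_iff_contDiff.2 ?_
      have h1 : ContDiff ℝ ∞ fun y ↦ D (univBall (0 : 𝔼 3) ε y) :=
        (contMDiff_iff_contDiff.1 D.contMDiff).comp contDiff_univBall
      refine (contDiffOn_univBall_symm (c := (0 : 𝔼 3)) (r := ε)).comp_contDiff h1 fun y ↦ ?_
      rw [mem_ball_zero_iff]
      exact norm_apply_lt_of_eq_self hε D hD (norm_univBall_zero_lt hε y)
    contMDiff_invFun := by
      refine contMDiff_iff_contDiff.2 ?_
      have h1 : ContDiff ℝ ∞ fun y ↦ D.symm (univBall (0 : 𝔼 3) ε y) :=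
        (contMDiff_iff_contDiff.1 D.symm.contMDiff).comp contDiff_univBall
      refine (contDiffOn_univBall_symm (c := (0 : 𝔼 3)) (r := ε)).comp_contDiff h1 fun y ↦ ?_
      rw [mem_ball_zero_iff]
      exact norm_symm_apply_lt_of_eq_self hε D hD (norm_univBall_zero_lt hε y) }

/-- The conjugate, pointwise (definitional). [folklore] -/
@[simp] theorem ballConj_apply (y : 𝔼 3) :
    ballConj hε D hD y = (univBall (0 : 𝔼 3) ε).symm (D (univBall (0 : 𝔼 3) ε y)) := rfl

/-- **`sh_ε (ballConj y) = D (sh_ε y)`.** [folklore] -/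
theorem univBall_ballConj_apply (y : 𝔼 3) :
    univBall (0 : 𝔼 3) ε (ballConj hε D hD y) = D (univBall (0 : 𝔼 3) ε y) :=
  (univBall (0 : 𝔼 3) ε).right_inv (by
    rw [univBall_target _ hε, mem_ball_zero_iff]
    exact norm_apply_lt_of_eq_self hε D hD (norm_univBall_zero_lt hε y))

/-- **Off `B(0, 7/2)` the conjugate is the identity.** [folklore] -/
theorem ballConj_of_le_norm {y : 𝔼 3} (hy : 7 / 2 ≤ ‖y‖) : ballConj hε D hD y = y := by
  rw [ballConj_apply, hD _ (le_norm_univBall_zero hε hy)]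
  exact (univBall (0 : 𝔼 3) ε).left_inv (by rw [univBall_source]; exact mem_univ _)

/-- The conjugate fixes `0` if `D` does. [folklore] -/
theorem ballConj_apply_zero (h0 : D 0 = 0) : ballConj hε D hD 0 = 0 := by
  rw [ballConj_apply, univBall_apply_zero, h0, univBall_symm_apply_center]

end Reframe

/-! ### Transport of the surgery along an ambient diffeomorphism -/

namespace CircleNbhd

variable {T T' : Type u} [TopologicalSpace T] [ChartedSpace (𝔼 4) T] [TopologicalSpace T']
  [ChartedSpace (𝔼 4) T'] [IsManifold (𝓡 4) ∞ T] [IsManifold (𝓡 4) ∞ T'] [T2Space T] [T2Space T']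
  {c : 𝕊 1 → T}

/-- **`ν.Surgered` is a surgery on `T'` along the transported tube `e ∘ ν`** (the gluing
embedding of the complement is precomposed with `e⁻¹`; the relation is unchanged). [folklore] -/
theorem isOpenGluing_surgered_map (ν : CircleNbhd (𝓡 4) c) (e : T ≃ₘ⟮𝓡 4, 𝓡 4⟯ T') :
    IsOpenGluing (𝓡 4) (𝓘(ℝ, 𝔼 2).prod (𝓡 2)) (𝓡 4) (A := ↥(ν.map e).complement)
      (B := ↥discTimesSphere) (P := ν.Surgered) (circleSurgeryRel (ν.map e)) := by
  obtain ⟨jA, jB, hA, hAo, hB, hBo, hU, hR⟩ := ν.isOpenGluing_surgered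
  have hsurj : Function.Surjective (fun a' ↦ (ν.complementMap e).symm a') :=
    fun a ↦ ⟨ν.complementMap e a, (ν.complementMap e).symm_apply_apply a⟩
  refine ⟨jA ∘ (ν.complementMap e).symm, jB, hA.comp_diffeomorph (ν.complementMap e).symm, ?_,
    hB, hBo, ?_, fun a' b ↦ ?_⟩
  · rwa [hsurj.range_comp]
  · rwa [hsurj.range_comp]
  · rw [Function.comp_apply, hR]
    simp only [circleSurgeryRel, CircleNbhd.coe_complementMap_symm_apply, CircleNbhd.map_apply]
    refine exists_congr fun u ↦ exists_congr fun t ↦ and_congr_right fun _ ↦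
      and_congr_right fun _ ↦ ?_
    constructor
    · intro h1
      rw [← h1, Diffeomorph.apply_symm_apply]
    · intro h1
      rw [h1, Diffeomorph.symm_apply_apply]

/-- **Transporting the tube along an ambient diffeomorphism does not change the surgery**:
`ν.Surgered ≅ (e ∘ ν).Surgered`. [cite: GompfStipsiczGSM1999, §5.2] -/
theorem nonempty_diffeomorph_surgered_map (ν : CircleNbhd (𝓡 4) c) (e : T ≃ₘ⟮𝓡 4, 𝓡 4⟯ T') :
    Nonempty (ν.Surgered ≃ₘ⟮𝓡 4, 𝓡 4⟯ (ν.map e).Surgered) :=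
  IsOpenGluing.nonempty_diffeomorph (ν.isOpenGluing_surgered_map e) (ν.map e).isOpenGluing_surgered

end CircleNbhd

/-! ### The conjugating diffeomorphism `Ψ : CSTorus A ≅ CSTorus (C A C⁻¹)` -/

section ConjTorus

variable (A C : Matrix.SpecialLinearGroup (Fin 3) ℤ)

/-- `C (A x) = (C A C⁻¹) (C x)` on `T³`. [folklore] -/
theorem torusMap_conj_apply (x : ThreeTorus) :
    torusDiffeomorph C (torusDiffeomorph A x) =
      torusDiffeomorph (C * A * C⁻¹) (torusDiffeomorph C x) := by
  calc torusDiffeomorph C (torusDiffeomorph A x) = torusDiffeomorph (C * A) x := by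
        rw [torusDiffeomorph_mul, Diffeomorph.coe_trans, comp_apply]
    _ = torusDiffeomorph (C * A * C⁻¹ * C) x := by rw [inv_mul_cancel_right]
    _ = torusDiffeomorph (C * A * C⁻¹) (torusDiffeomorph C x) := by
        rw [torusDiffeomorph_mul (C * A * C⁻¹) C, Diffeomorph.coe_trans, comp_apply]

/-- **`CSTorus (C A C⁻¹)` is an open gluing of the two cylinders along the relation of `A`**, with
witnesses `inl ∘ (C × id)`, `inr ∘ (C × id)` (conjugating the gluing relation,
`mappingTorusRel_prodMap_iff'`). [cite: GompfAGT2010, §3 ¶1 (the pair only depends on the conjugacy class of A)] -/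
theorem isOpenGluingWith_csTorus_conj :
    IsOpenGluingWith (ModelWithCorners.prod 𝓣 𝓘(ℝ, ℝ)) (ModelWithCorners.prod 𝓣 𝓘(ℝ, ℝ)) (𝓡 4)
      (mappingTorusRel ⇑(torusDiffeomorph A))
      ((csGlueData (C * A * C⁻¹)).inl ∘ Prod.map ⇑(torusDiffeomorph C) id)
      ((csGlueData (C * A * C⁻¹)).inr ∘ Prod.map ⇑(torusDiffeomorph C) id) := by
  obtain ⟨hA, hAo, hB, hBo, hU, hR⟩ :=
    isOpenGluingWith_mappingTorusGlued (torusDiffeomorph (C * A * C⁻¹)) linTorusModel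
  have h1 : Function.Surjective
      (Prod.map ⇑(torusDiffeomorph C) (id : ↥mappingTorusPieceOne → ↥mappingTorusPieceOne)) :=
    (EquivLike.surjective _).prodMap Function.surjective_id
  have h2 : Function.Surjective
      (Prod.map ⇑(torusDiffeomorph C) (id : ↥mappingTorusPieceTwo → ↥mappingTorusPieceTwo)) :=
    (EquivLike.surjective _).prodMap Function.surjective_id
  refine ⟨?_, ?_, ?_, ?_, ?_, fun a b ↦ ?_⟩
  · have := hA.comp_diffeomorph
      ((torusDiffeomorph C).prodCongr (Diffeomorph.refl 𝓘(ℝ, ℝ) ↥mappingTorusPieceOne ∞))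
    simpa only [Diffeomorph.coe_prodCongr, Diffeomorph.coe_refl] using this
  · rwa [h1.range_comp]
  · have := hB.comp_diffeomorph
      ((torusDiffeomorph C).prodCongr (Diffeomorph.refl 𝓘(ℝ, ℝ) ↥mappingTorusPieceTwo ∞))
    simpa only [Diffeomorph.coe_prodCongr, Diffeomorph.coe_refl] using this
  · rwa [h2.range_comp]
  · rwa [h1.range_comp, h2.range_comp]
  · rw [Function.comp_apply, Function.comp_apply, hR]
    exact mappingTorusRel_prodMap_iff' (EquivLike.injective _) (torusMap_conj_apply A C) a b

/-- **The conjugating diffeomorphism exists**: `Ψ : CSTorus A ≅ CSTorus (C A C⁻¹)` with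
`Ψ [x, s] = [C x, s]` on both cylinders (uniqueness of open gluings with witnesses). [cite: GompfAGT2010, §3 ¶1 (the pair only depends on the conjugacy class of A)] -/
theorem exists_csConj : ∃ Ψ : CSTorus A ≃ₘ⟮𝓡 4, 𝓡 4⟯ CSTorus (C * A * C⁻¹),
    (∀ a, Ψ ((csGlueData A).inl a) =
      (csGlueData (C * A * C⁻¹)).inl (torusMap (C : Matrix (Fin 3) (Fin 3) ℤ) a.1, a.2)) ∧
    (∀ b, Ψ ((csGlueData A).inr b) =
      (csGlueData (C * A * C⁻¹)).inr (torusMap (C : Matrix (Fin 3) (Fin 3) ℤ) b.1, b.2)) :=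
  (isOpenGluingWith_mappingTorusGlued (torusDiffeomorph A) linTorusModel).exists_diffeomorph_apply_eq
    (isOpenGluingWith_csTorus_conj A C)

/-- **The conjugating diffeomorphism `Ψ_C : CSTorus A ≅ CSTorus (C A C⁻¹)`**, `[x, s] ↦ [C x, s]`
(descended from `torusMap C × id` on the cylinders). [cite: GompfAGT2010, §3 ¶1 (the pair only depends on the conjugacy class of A)] -/
def csConj : CSTorus A ≃ₘ⟮𝓡 4, 𝓡 4⟯ CSTorus (C * A * C⁻¹) := (exists_csConj A C).choose

/-- `Ψ` on the first cylinder. [folklore] -/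
theorem csConj_inl (a : ThreeTorus × ↥mappingTorusPieceOne) :
    csConj A C ((csGlueData A).inl a) =
      (csGlueData (C * A * C⁻¹)).inl (torusMap (C : Matrix (Fin 3) (Fin 3) ℤ) a.1, a.2) :=
  (exists_csConj A C).choose_spec.1 a

/-- `Ψ` on the second cylinder. [folklore] -/
theorem csConj_inr (b : ThreeTorus × ↥mappingTorusPieceTwo) :
    csConj A C ((csGlueData A).inr b) =
      (csGlueData (C * A * C⁻¹)).inr (torusMap (C : Matrix (Fin 3) (Fin 3) ℤ) b.1, b.2) :=
  (exists_csConj A C).choose_spec.2 b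

variable (γ : SmoothMatrixPath (slRealMatrix A))

/-- **`Ψ` maps the section circle to the section circle** (both are the zero sections `[1, s]`,
and `C · 1 = 1`). [folklore] -/
theorem csConj_comp_sectionCircle :
    ⇑(csConj A C) ∘ sectionCircle A γ = sectionCircle (C * A * C⁻¹) (γ.conj C) := by
  funext u
  by_cases hu : u = ptA
  · subst hu
    rw [comp_apply, sectionCircle_of_ne_ptB A γ ptA_ne_ptB,
      sectionCircle_of_ne_ptB (C * A * C⁻¹) (γ.conj C) ptA_ne_ptB, csConj_inr]
    dsimp only
    rw [torusMap_apply_one]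
  · rw [comp_apply, sectionCircle_of_ne A γ hu, sectionCircle_of_ne (C * A * C⁻¹) (γ.conj C) hu,
      csConj_inl]
    dsimp only
    rw [torusMap_apply_one]

end ConjTorus

/-! ### The fibre data of the comparison -/

section FibreData

variable (A C : Matrix.SpecialLinearGroup (Fin 3) ℤ) (γ : SmoothMatrixPath (slRealMatrix A))

/-- `mulVecE` commutes with scalars. [folklore] -/
theorem mulVecE_smul (M : Matrix (Fin 3) (Fin 3) ℝ) (a : ℝ) (v : 𝔼 3) :
    mulVecE M (a • v) = a • mulVecE M v := by
  rw [← matCLM_apply, ← matCLM_apply, map_smul]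

/-- **The near-identity factors of `C⁻¹`** (as an operator on `ℝ³`), within `fibreThreshold` of the
identity, with product `C⁻¹`. [folklore] -/
def conjFactors : List (𝔼 3 →L[ℝ] 𝔼 3) :=
  (exists_list_prod_eq_matCLM C⁻¹ fibreThreshold_pos).choose

/-- The factors are within the threshold. [folklore] -/
theorem norm_sub_one_le_of_mem_conjFactors {L : 𝔼 3 →L[ℝ] 𝔼 3} (hL : L ∈ conjFactors C) :
    ‖L - 1‖ ≤ fibreThreshold :=
  (exists_list_prod_eq_matCLM C⁻¹ fibreThreshold_pos).choose_spec.1 L hL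

/-- The factors are within the straightening threshold. [folklore] -/
theorem norm_sub_one_le_threshold_of_mem_conjFactors {L : 𝔼 3 →L[ℝ] 𝔼 3}
    (hL : L ∈ conjFactors C) : ‖L - 1‖ ≤ straightenThreshold (coreBump (E := 𝔼 3)) :=
  (norm_sub_one_le_of_mem_conjFactors C hL).trans (min_le_left _ _)

/-- The factors have norm `≤ 7/6`. [folklore] -/
theorem norm_le_of_mem_conjFactors {L : 𝔼 3 →L[ℝ] 𝔼 3} (hL : L ∈ conjFactors C) :
    ‖L‖ ≤ 7 / 6 := by
  have h1 : ‖L - 1‖ ≤ 1 / 6 := (norm_sub_one_le_of_mem_conjFactors C hL).trans (min_le_right _ _)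
  have h2 : ‖(1 : 𝔼 3 →L[ℝ] 𝔼 3)‖ ≤ 1 := ContinuousLinearMap.norm_id_le
  calc ‖L‖ = ‖(L - 1) + 1‖ := by rw [sub_add_cancel]
    _ ≤ ‖L - 1‖ + ‖(1 : 𝔼 3 →L[ℝ] 𝔼 3)‖ := norm_add_le _ _
    _ ≤ 7 / 6 := by linarith

/-- The product of the factors is the operator `C⁻¹`. [folklore] -/
theorem prod_conjFactors : (conjFactors C).prod = matCLM (slRealMatrix C⁻¹) :=
  (exists_list_prod_eq_matCLM C⁻¹ fibreThreshold_pos).choose_spec.2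

/-- The ratio `ε'/ε` of the radius of the conjugate tube to the radius of the tube. [folklore] -/
def conjRatio : ℝ := twistRadius (C * A * C⁻¹) (γ.conj C) / twistRadius A γ

/-- `ε'/ε > 0`. [folklore] -/
theorem conjRatio_pos : 0 < conjRatio A C γ :=
  div_pos (twistRadius_pos _ _) (twistRadius_pos _ _)

/-- **The scalar `c := min ((6/7)^{|l|}) (ε'/ε)`** inserted into the change of fibre coordinates. [folklore] -/
def conjScale : ℝ := min ((6 / 7 : ℝ) ^ (conjFactors C).length) (conjRatio A C γ)

/-- `c > 0`. [folklore] -/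
theorem conjScale_pos : 0 < conjScale A C γ := lt_min (by positivity) (conjRatio_pos A C γ)

/-- `c ≤ (6/7)^{|l|}`. [folklore] -/
theorem conjScale_le_pow : conjScale A C γ ≤ (6 / 7 : ℝ) ^ (conjFactors C).length := min_le_left _ _

/-- `c ≤ ε'/ε`. [folklore] -/
theorem conjScale_le_conjRatio : conjScale A C γ ≤ conjRatio A C γ := min_le_right _ _

/-- **The shrink factor `κ := c ε / ε' ∈ (0, 1]`** on the side of the conjugate tube. [folklore] -/
def conjKappa : ℝ := conjScale A C γ / conjRatio A C γ

/-- `κ > 0`. [folklore] -/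
theorem conjKappa_pos : 0 < conjKappa A C γ := div_pos (conjScale_pos A C γ) (conjRatio_pos A C γ)

/-- `κ ≤ 1`. [folklore] -/
theorem conjKappa_le_one : conjKappa A C γ ≤ 1 :=
  (div_le_one (conjRatio_pos A C γ)).2 (conjScale_le_conjRatio A C γ)

/-- `κ · (ε'/ε) = c`. [folklore] -/
theorem conjKappa_mul_conjRatio : conjKappa A C γ * conjRatio A C γ = conjScale A C γ :=
  div_mul_cancel₀ _ (conjRatio_pos A C γ).ne'

/-- **The core diffeomorphism `T`** of the comparison (`= c · C⁻¹` on the core ball, the identity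
near and beyond the sphere of radius `ε`). [folklore] -/
def conjCore : 𝔼 3 ≃ₘ⟮𝓘(ℝ, 𝔼 3), 𝓘(ℝ, 𝔼 3)⟯ 𝔼 3 :=
  (exists_diffeomorph_reframeCoreFun (twistRadius_pos A γ) (conjFactors C)
    (fun _ hL ↦ norm_sub_one_le_threshold_of_mem_conjFactors C hL) (conjScale A C γ)).choose

/-- `T` as a function. [folklore] -/
theorem coe_conjCore :
    ⇑(conjCore A C γ) = reframeCoreFun (twistRadius_pos A γ) (conjFactors C) (conjScale A C γ) :=
  (exists_diffeomorph_reframeCoreFun (twistRadius_pos A γ) (conjFactors C)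
    (fun _ hL ↦ norm_sub_one_le_threshold_of_mem_conjFactors C hL) (conjScale A C γ)).choose_spec

/-- `T` is the identity near and beyond the sphere of radius `ε`. [folklore] -/
theorem conjCore_of_le_norm (y : 𝔼 3) (hy : twistRadius A γ * (24 / 25) ≤ ‖y‖) :
    conjCore A C γ y = y := by
  rw [coe_conjCore]
  exact reframeCoreFun_of_le_norm _ _ _ hy

/-- **The fibre diffeomorphism `g = sh_ε⁻¹ ∘ T ∘ sh_ε`** on the side of `A`. [folklore] -/
def conjFibre : 𝔼 3 ≃ₘ⟮𝓘(ℝ, 𝔼 3), 𝓘(ℝ, 𝔼 3)⟯ 𝔼 3 :=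
  ballConj (twistRadius_pos A γ) (conjCore A C γ) (conjCore_of_le_norm A C γ)

/-- **The tube reparametrisation `(u, w) ↦ (u, g w)`** on the side of `A`. [cite: GompfStipsiczGSM1999, §5.2] -/
def conjTubeDiffeo : TubeDiffeo :=
  TubeDiffeo.ofFibre (conjFibre A C γ) (7 / 2)
    (ballConj_apply_zero _ _ _ (by rw [coe_conjCore, reframeCoreFun_apply_zero]))
    (fun _ hw ↦ ballConj_of_le_norm _ _ _ hw)

/-- The tube reparametrisation, pointwise. [folklore] -/
@[simp] theorem conjTubeDiffeo_apply (u : 𝕊 1) (w : 𝔼 3) :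
    (conjTubeDiffeo A C γ).toDiffeomorph (u, w) = (u, conjFibre A C γ w) :=
  TubeDiffeo.ofFibre_apply _ _ _ _ u w

/-- **The shrink `k = sh_{ε'}⁻¹ ∘ (κ ·) ∘ sh_{ε'}`** on the side of `C A C⁻¹` (`tubeFibreDiffeo` with
the identity operator). [folklore] -/
def conjShrink : 𝔼 3 ≃ₘ⟮𝓘(ℝ, 𝔼 3), 𝓘(ℝ, 𝔼 3)⟯ 𝔼 3 :=
  tubeFibreDiffeo (twistRadius_pos (C * A * C⁻¹) (γ.conj C)) (conjKappa A C γ) 1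
    (by rw [sub_self, norm_zero]; exact straightenThreshold_pos _)

/-- `k` as a function. [folklore] -/
theorem coe_conjShrink : ⇑(conjShrink A C γ) =
    tubeFibreFun (twistRadius_pos (C * A * C⁻¹) (γ.conj C)) (conjKappa A C γ) 1 :=
  coe_tubeFibreDiffeo _ _ _ _

/-- **The tube reparametrisation `(u, w) ↦ (u, k w)`** on the side of `C A C⁻¹`. [cite: GompfStipsiczGSM1999, §5.2] -/
def conjShrinkTubeDiffeo : TubeDiffeo :=
  TubeDiffeo.ofFibre (conjShrink A C γ) (7 / 2)
    (by rw [coe_conjShrink, tubeFibreFun_apply_zero])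
    (fun _ hw ↦ by rw [coe_conjShrink]; exact tubeFibreFun_of_le_norm _ _ _ hw)

/-- The shrink reparametrisation, pointwise. [folklore] -/
@[simp] theorem conjShrinkTubeDiffeo_apply (u : 𝕊 1) (w : 𝔼 3) :
    (conjShrinkTubeDiffeo A C γ).toDiffeomorph (u, w) = (u, conjShrink A C γ w) :=
  TubeDiffeo.ofFibre_apply _ _ _ _ u w

/-- **On the unit ball, `sh_ε (g w) = c · C⁻¹ (sh_ε w)`.** [folklore] -/
theorem shrink_conjFibre {w : 𝔼 3} (hw : ‖w‖ ≤ 1) :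
    (twistA A γ).shrink (conjFibre A C γ w) =
      conjScale A C γ • mulVecE (slRealMatrix C⁻¹) ((twistA A γ).shrink w) := by
  show univBall (0 : 𝔼 3) (twistRadius A γ) (ballConj (twistRadius_pos A γ) (conjCore A C γ)
    (conjCore_of_le_norm A C γ) w) = conjScale A C γ • mulVecE (slRealMatrix C⁻¹)
      (univBall (0 : 𝔼 3) (twistRadius A γ) w)
  rw [univBall_ballConj_apply, coe_conjCore,
    reframeCoreFun_of_norm_le (twistRadius_pos A γ) (fun L hL ↦ norm_le_of_mem_conjFactors C hL)
      (conjScale_pos A C γ) (conjScale_le_pow A C γ) (norm_univBall_zero_le (twistRadius_pos A γ) hw),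
    prod_conjFactors, matCLM_apply]

/-- The two shrinking maps differ by the radius ratio: `sh_{ε'} = (ε'/ε) · sh_ε`. [folklore] -/
theorem shrink_conj_eq_smul (w : 𝔼 3) :
    (twistA (C * A * C⁻¹) (γ.conj C)).shrink w = conjRatio A C γ • (twistA A γ).shrink w := by
  show univBall (0 : 𝔼 3) (twistRadius (C * A * C⁻¹) (γ.conj C)) w =
    conjRatio A C γ • univBall (0 : 𝔼 3) (twistRadius A γ) w
  rw [univBall_zero_eq_smul (twistRadius_pos _ _), univBall_zero_eq_smul (twistRadius_pos A γ),
    smul_smul (conjRatio A C γ) (twistRadius A γ), conjRatio,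
    div_mul_cancel₀ _ (twistRadius_pos A γ).ne']

/-- **On the unit ball, `sh_{ε'} (k w) = c · sh_ε w`.** [folklore] -/
theorem shrink_conjShrink {w : 𝔼 3} (hw : ‖w‖ ≤ 1) :
    (twistA (C * A * C⁻¹) (γ.conj C)).shrink (conjShrink A C γ w) =
      conjScale A C γ • (twistA A γ).shrink w := by
  have hε' := twistRadius_pos (C * A * C⁻¹) (γ.conj C)
  have hn : ‖(1 : 𝔼 3 →L[ℝ] 𝔼 3)‖ ≤ 7 / 6 := ContinuousLinearMap.norm_id_le.trans (by norm_num)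
  have hz : conjKappa A C γ • (twistA (C * A * C⁻¹) (γ.conj C)).shrink w ∈
      ball (0 : 𝔼 3) (twistA (C * A * C⁻¹) (γ.conj C)).ε := by
    rw [mem_ball_zero_iff, norm_smul, Real.norm_of_nonneg (conjKappa_pos A C γ).le]
    calc conjKappa A C γ * ‖(twistA (C * A * C⁻¹) (γ.conj C)).shrink w‖
        ≤ 1 * ‖(twistA (C * A * C⁻¹) (γ.conj C)).shrink w‖ :=
          mul_le_mul_of_nonneg_right (conjKappa_le_one A C γ) (norm_nonneg _)
      _ < (twistA (C * A * C⁻¹) (γ.conj C)).ε := by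
          rw [one_mul]; exact (twistA (C * A * C⁻¹) (γ.conj C)).norm_shrink_lt w
  rw [coe_conjShrink, tubeFibreFun_of_norm_le hε' (conjKappa_pos A C γ) (conjKappa_le_one A C γ) hn hw,
    one_apply_eq_self]
  show (twistA (C * A * C⁻¹) (γ.conj C)).shrink ((twistA (C * A * C⁻¹) (γ.conj C)).shrink.symm
    (conjKappa A C γ • (twistA (C * A * C⁻¹) (γ.conj C)).shrink w)) = _
  rw [(twistA (C * A * C⁻¹) (γ.conj C)).shrink_apply_symm_apply hz, shrink_conj_eq_smul A C γ,
    smul_smul, conjKappa_mul_conjRatio]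

/-- The common value of both sides of the fibre comparison: `C M (c C⁻¹ x) = (C M C⁻¹) (c x)`. [folklore] -/
theorem mulVecE_conj_smul (M : Matrix (Fin 3) (Fin 3) ℝ) (a : ℝ) (x : 𝔼 3) :
    mulVecE (slRealMatrix C) (mulVecE M (a • mulVecE (slRealMatrix C⁻¹) x)) =
      mulVecE (slRealMatrix C * M * slRealMatrix C⁻¹) (a • x) := by
  rw [mulVecE_smul, mulVecE_smul, mulVecE_smul, mulVecE_mulVecE, mulVecE_mulVecE]

/-- **Over the first cylinder the tubes correspond**: `C · texp_γ s (g w) = texp_{γ^C} s (k w)`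
(`‖w‖ ≤ 1`). [folklore] -/
theorem texp_twistA_conj (s : ℝ) {w : 𝔼 3} (hw : ‖w‖ ≤ 1) :
    torusMap (C : Matrix (Fin 3) (Fin 3) ℤ) ((twistA A γ).texp s (conjFibre A C γ w)) =
      (twistA (C * A * C⁻¹) (γ.conj C)).texp s (conjShrink A C γ w) := by
  simp only [TubeTwist.texp]
  show torusMap _ (expT (mulVecE (γ.toFun (2 * s)) _)) =
    expT (mulVecE ((γ.conj C).toFun (2 * s)) _)
  rw [torusMap_expT', shrink_conjFibre A C γ hw, shrink_conjShrink A C γ hw,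
    SmoothMatrixPath.conj_toFun, mulVecE_conj_smul]

/-- **Over the second cylinder, at `ptA`, the tubes correspond.** [folklore] -/
theorem texp_twistB_conj_ptA {w : 𝔼 3} (hw : ‖w‖ ≤ 1) :
    torusMap (C : Matrix (Fin 3) (Fin 3) ℤ) ((twistB A γ).texp (angBPt ptA) (conjFibre A C γ w)) =
      (twistB (C * A * C⁻¹) (γ.conj C)).texp (angBPt ptA) (conjShrink A C γ w) := by
  have h1 : ((angBPt ptA : ℝ)) ≤ 1 := coe_angBPt_ptA.le
  rw [texp_twistB_of_le A γ h1, texp_twistB_of_le (C * A * C⁻¹) (γ.conj C) h1, torusMap_expT',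
    shrink_conjFibre A C γ hw, shrink_conjShrink A C γ hw, slRealMatrix_mul, slRealMatrix_mul,
    mulVecE_conj_smul]

/-- **The tubes correspond on the unit ball bundle**: `Ψ (ν_γ (u, g w)) = ν_{γ^C} (u, k w)` for
`‖w‖ ≤ 1`. [cite: GompfAGT2010, Thm 4.3 (proof: conjugation preserves linear straightenings)] -/
theorem secNbhdFun_conj_eq (u : 𝕊 1) {w : 𝔼 3} (hw : ‖w‖ ≤ 1) :
    csConj A C (secNbhdFun A γ (u, conjFibre A C γ w)) =
      secNbhdFun (C * A * C⁻¹) (γ.conj C) (u, conjShrink A C γ w) := by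
  by_cases hu : u = ptA
  · subst hu
    rw [secNbhdFun_of_ne_ptB A γ
        (show ((ptA, conjFibre A C γ w) : (𝕊 1) × 𝔼 3).1 ≠ ptB from ptA_ne_ptB),
      secNbhdFun_of_ne_ptB (C * A * C⁻¹) (γ.conj C)
        (show ((ptA, conjShrink A C γ w) : (𝕊 1) × 𝔼 3).1 ≠ ptB from ptA_ne_ptB),
      TubeTwist.tubeB_apply, TubeTwist.tubeB_apply, csConj_inr]
    dsimp only
    rw [texp_twistB_conj_ptA A C γ hw]
  · rw [secNbhdFun_of_ne A γ (show ((u, conjFibre A C γ w) : (𝕊 1) × 𝔼 3).1 ≠ ptA from hu),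
      secNbhdFun_of_ne (C * A * C⁻¹) (γ.conj C)
        (show ((u, conjShrink A C γ w) : (𝕊 1) × 𝔼 3).1 ≠ ptA from hu),
      TubeTwist.tubeA_apply, TubeTwist.tubeA_apply, csConj_inl]
    dsimp only
    rw [texp_twistA_conj A C γ _ hw]

end FibreData

/-! ### Conjugation invariance -/

section Main

variable (A C : Matrix.SpecialLinearGroup (Fin 3) ℤ) (γ : SmoothMatrixPath (slRealMatrix A))

/-- **`X^{C γ C⁻¹}_{C A C⁻¹} ≅ X^γ_A`.** The Gompf sphere of the conjugate matrix framed by the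
conjugate path is diffeomorphic to the Gompf sphere of `A` framed by `γ`: transport the tube along
`Ψ_C`, reparametrise it by the compactly supported fibre diffeomorphism `g`, and compare with the
shrunk conjugate tube on the unit ball bundle. [cite: GompfAGT2010, §3 ¶1 and Thm 4.3 (proof: conjugation preserves linear straightenings, X^{σ_A}_A ≅ X^{σ_B}_B)] [cite: GompfStipsiczGSM1999, §5.2] -/
theorem nonempty_diffeomorph_gompfSphere_conj :
    Nonempty (gompfSphere (C * A * C⁻¹) (γ.conj C) ≃ₘ⟮𝓡 4, 𝓡 4⟯ gompfSphere A γ) := by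
  obtain ⟨e₁⟩ := (sectionCircleNbhd A γ).nonempty_diffeomorph_surgered_map (csConj A C)
  obtain ⟨e₂⟩ := ((sectionCircleNbhd A γ).map (csConj A C)).nonempty_diffeomorph_surgered_twist
    (conjTubeDiffeo A C γ)
  obtain ⟨e₃⟩ := (sectionCircleNbhd (C * A * C⁻¹) (γ.conj C)).nonempty_diffeomorph_surgered_of_eqOn_twist_of_eq
    (conjShrinkTubeDiffeo A C γ)
    (((sectionCircleNbhd A γ).map (csConj A C)).twist (conjTubeDiffeo A C γ))
    (csConj_comp_sectionCircle A C γ).symm (fun u w hw ↦ by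
      show csConj A C (secNbhdFun A γ ((conjTubeDiffeo A C γ).toDiffeomorph (u, w))) =
        secNbhdFun (C * A * C⁻¹) (γ.conj C) ((conjShrinkTubeDiffeo A C γ).toDiffeomorph (u, w))
      rw [conjTubeDiffeo_apply, conjShrinkTubeDiffeo_apply]
      exact secNbhdFun_conj_eq A C γ u hw.le)
  exact ⟨e₃.trans (e₂.symm.trans e₁.symm)⟩

/-- **Leaf Cj discharged: `Literature.Topology.FourManifolds.gompf2010_conj_invariance` holds.** [cite: GompfAGT2010, §3 ¶1 and Thm 4.3 (proof: conjugation preserves linear straightenings, X^{σ_A}_A ≅ X^{σ_B}_B)] -/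
theorem gompf2010_conj_invariance_holds : gompf2010_conj_invariance :=
  fun A C γ ↦ nonempty_diffeomorph_gompfSphere_conj A C γ

end Main

end Literature.Topology.FourManifolds
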